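import Summits.BirchSwinnertonDyer.BirchSwinnertonDyer.Theorems.ByReductionTypeAtTwoTowerLayerTorsion
import HarnessLib

/-!
# The torsion charge of the TOWER-gap count is the `p`-RANK of `E(K_∞)[p^∞]`:
# `#Sel_{p^∞}(E/K_n)[p] ≤ #(ker h_n)[p] · #T_n`, `#A_n[p] ≤ #(ker h_n)[p] · #T_n` and `#(ker h_n)[p] ≤ #E(K_∞)[p]`
# (route ByReductionTypeAtTwo, items 19271 / 19573, TOWER road on the 86 INELIG classes; seat bsd-2adic-tower-1 GEN 6, part 1 of 2)

HONEST FRAMING (cell `bsd-2adic`, run/shared/lean/pub/bsd-2adic/, HUMAN RULINGS D-0036 / D-0054 / D-0074):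
THEOREMS ONLY; nothing asserted; no definition; no new named fact; closes nothing by itself; BSD is not
proved by any of this.

The torsion-tolerant gap doors of the TOWER road (`TowerClass.towerGapAtTwo_of_counts_of_torsion`, ord-2 GEN 4,
file `…TowerLayerTorsion`; `TowerClass.towerGapAtTwo_of_classCounts_of_torsion`, KitE) pay for the rational
`2`-torsion with the binder `htor : #E[2^∞]^{Gal(ℚ̄/ℚ_j)} ≤ 2^t`, i.e. with the WHOLE order of
`ker h_j ≅ B/(γ^{2^j} − 1)B` (`B = E(ℚ_∞)[2^∞]`, Greenberg's Lemma 3.1 / 4.3; tree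
`WeierstrassCurve.kerLayerToInftyEquiv`), certified per class by a point count `#Ẽ(𝔽_ℓ)` at a good prime `ℓ`
splitting completely in `ℚ_j`. But the count that enters, `#Sel_{2^∞}(E/ℚ_j)[2] ≤ #ker h_j · #T_j`, only ever
meets `2`-TORSION classes: the kernel of `h_j` on `Sel_j[2]` lies in `(ker h_j)[2]`, and
`(ker h_j)[2] ≅ (B/(γ^{2^j} − 1)B)[2]` has at most `#(B/2B) = #B[2] = #E(ℚ_∞)[2] ≤ #E[2] = 4` elements — the
`2`-RANK of `B`, not its order. This part (any number field `K`, prime `p`, `ℤ_p`-extension `κ`, layer `n`):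

* §1 (finite abelian groups): `natCard_nsmulTorsion_quotient_le` — `#(B/R)[m] ≤ #B[m]`.
* §2 (`B = E(K_∞)[p^∞]` finite): `natCard_pTorsion_ker_layerToInfty_le` — **`#(ker h_n)[p] ≤ #B[p] = #E(K_∞)[p]`**.
* §3: the layer counts of `…TowerLayerTorsion` §1 / KitE §1 with `#(ker h_n)[p]` in place of `#ker h_n`:
  `natCard_selmerLayer_pTorsion_le_pTorsionKer_mul` (`#Sel_{p^∞}(E/K_n)[p] ≤ #(ker h_n)[p] · #T_n`),
  `natCard_layerClasses_pTorsion_le_pTorsionKer_mul` (`#A_n[p] ≤ #(ker h_n)[p] · #T_n`) — same proofs, the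
  kernel lands in `(ker h_n)[p]`.
Part 2 (`…TowerClassKitR`) turns them into the `p = 2` gap doors with the binder `#E(ℚ_∞)[2] ≤ 2^t` and
discharges `t = 2` for every curve, `t = 0` for irreducible `E[2]`.

References: [GreenbergLNM1716] R. Greenberg, LNM 1716 (1999), §1 p. 60 and p. 62, §3 pp. 85–86 (Lemmas 3.1,
3.2), §4 Lemma 4.3 (p. 103); [Washington1997] §13.2.
-/

set_option autoImplicit false
-- the route's Theorems namespace repeats a component by design (summit = sub-problem, D-0017).
set_option linter.dupNamespace false

noncomputable section

open scoped Classical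

open WeierstrassCurve Literature.NumberTheory.EllipticCurves PowerSeries
  Summit.BirchSwinnertonDyer.Rank1Residual Summit.BirchSwinnertonDyer.Rank1Residual.X5.TowerGap

universe u

namespace Summit.BirchSwinnertonDyer.BirchSwinnertonDyer.Theorems.TowerLayer

/-! ## §1 `#(B/R)[m] ≤ #B[m]` for a finite abelian group -/

section Finite

/-- **The `m`-torsion of a quotient of a finite abelian group `B` is at most `#B[m]`**: for any `Q`,
`#Q[m] = #(Q/mQ)` (`#Q = #Q[m]·#mQ = #(Q/mQ)·#mQ`, tree `ResKernel.natCard_quotient_range_eq_natCard_ker`), and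
`Q/mQ` is a quotient of `B/mB` when `Q` is a quotient of `B`. [folklore] -/
theorem natCard_nsmulTorsion_quotient_le {B : Type*} [AddCommGroup B] [Finite B] (R : AddSubgroup B) (m : ℕ) :
    Nat.card {q : B ⧸ R // m • q = 0} ≤ Nat.card {b : B // m • b = 0} := by
  let fB : B →+ B := DistribSMul.toAddMonoidHom B m
  let fQ : B ⧸ R →+ B ⧸ R := DistribSMul.toAddMonoidHom (B ⧸ R) m
  have hB : Nat.card {b : B // m • b = 0} = Nat.card (B ⧸ fB.range) := by
    rw [ResKernel.natCard_quotient_range_eq_natCard_ker]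
    exact Nat.card_congr (Equiv.subtypeEquivRight fun b ↦ by
      rw [AddMonoidHom.mem_ker, DistribSMul.toAddMonoidHom_apply])
  have hQ : Nat.card {q : B ⧸ R // m • q = 0} = Nat.card ((B ⧸ R) ⧸ fQ.range) := by
    rw [ResKernel.natCard_quotient_range_eq_natCard_ker]
    exact Nat.card_congr (Equiv.subtypeEquivRight fun q ↦ by
      rw [AddMonoidHom.mem_ker, DistribSMul.toAddMonoidHom_apply])
  let π : B →+ B ⧸ R := QuotientAddGroup.mk' R
  have hle : fB.range ≤ fQ.range.comap π := by
    rintro _ ⟨b, rfl⟩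
    refine ⟨π b, ?_⟩
    simp only [fB, fQ, DistribSMul.toAddMonoidHom_apply, map_nsmul]
  have hg : Function.Surjective (QuotientAddGroup.map fB.range fQ.range π hle) := by
    intro x
    induction x using QuotientAddGroup.induction_on with
    | H q =>
      induction q using QuotientAddGroup.induction_on with
      | H b => exact ⟨(b : B ⧸ fB.range), rfl⟩
  rw [hQ, hB]
  exact Nat.card_le_card_of_surjective _ hg

end Finite

/-! ## §2 `#(ker h_n)[p] ≤ #E(K_∞)[p]` -/

section Layer

variable {K : Type u} [Field K] [NumberField K] (W : WeierstrassCurve K) {p : ℕ}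
  [hp : Fact p.Prime] (κ : ZpExtension K p)

/-- **`#(ker h_n)[p] ≤ #B[p]`**, `B = E(K_∞)[p^∞] = E[p^∞]^{Gal(K̄/K_∞)}` finite: `ker h_n ≃ B/(γ^{pⁿ} − 1)B`
(Greenberg's Lemma 3.1, tree `WeierstrassCurve.kerLayerToInftyEquiv`, `γ` any element with `κ γ = 1`) and §1.
I.e. the `p`-torsion of `ker h_n = H¹(Γ_n, B)` is bounded by the `p`-RANK `#B[p] = #E(K_∞)[p] ≤ p²` of `B`, for
every `n`. [cite: GreenbergLNM1716, §3 Lemma 3.1 (p. 86) and §4 Lemma 4.3 (p. 103)] -/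
theorem natCard_pTorsion_ker_layerToInfty_le (n : ℕ)
    [Finite (FixedPoints.addSubgroup κ.kerSubgroup (geomPrimaryTorsion W p))] :
    Nat.card {y : (W.layerToInfty κ n).ker // p • y = 0} ≤
      Nat.card {b : FixedPoints.addSubgroup κ.kerSubgroup (geomPrimaryTorsion W p) // p • b = 0} := by
  obtain ⟨γ, hγ⟩ := κ.surjective (Multiplicative.ofAdd 1)
  have hγ' : κ.IsTopGenerator γ := hγ
  let e := W.kerLayerToInftyEquiv κ hγ' n
  have h1 : Nat.card {y : (W.layerToInfty κ n).ker // p • y = 0} =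
      Nat.card {q : FixedPoints.addSubgroup κ.kerSubgroup (geomPrimaryTorsion W p) ⧸
        (ResKernel.subOne κ.kerSubgroup (geomPrimaryTorsion W p) (γ ^ p ^ n)).range // p • q = 0} :=
    Nat.card_congr (@Equiv.subtypeEquiv _ _ (fun y ↦ p • y = 0) (fun q ↦ p • q = 0) e.toEquiv
      (fun y ↦ by
        show p • y = 0 ↔ p • e y = 0
        rw [← map_nsmul, AddEquiv.map_eq_zero_iff]))
  rw [h1]
  exact natCard_nsmulTorsion_quotient_le _ p

/-! ## §3 The layer counts with `#(ker h_n)[p]` -/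

/-- **`#Sel_{p^∞}(E/K_n)[p] ≤ #(ker h_n)[p] · #T_n`** (`T_n = Sel_∞[p]^{γ^{pⁿ}}`): `h_n` carries `Sel_n[p]` into
`T_n` (`selmerLayer_le_selmerInftyPreimage`, `conjH1_pow_layerToInfty`) and its kernel there consists of
`p`-TORSION classes of `ker h_n` — the sharpening of `natCard_selmerLayer_pTorsion_le_mul` (same proof, the kernel
lands in `(ker h_n)[p]`). [cite: GreenbergLNM1716, §1 Thm. 1.2 and §3 pp. 85–86] -/
theorem natCard_selmerLayer_pTorsion_le_pTorsionKer_mul (γ : Field.absoluteGaloisGroup K) (n : ℕ)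
    (hfin : Finite (W.layerToInfty κ n).ker)
    (hT : Finite {s : W.selmerInfty κ // p • s = 0 ∧
      W.conjH1 p κ.kerSubgroup (γ ^ p ^ n) (s : W.subgroupH1 p κ.kerSubgroup) = s}) :
    Nat.card {z : W.selmerLayer κ n // p • z = 0} ≤
      Nat.card {y : (W.layerToInfty κ n).ker // p • y = 0} * Nat.card {s : W.selmerInfty κ // p • s = 0 ∧
        W.conjH1 p κ.kerSubgroup (γ ^ p ^ n) (s : W.subgroupH1 p κ.kerSubgroup) = s} := by
  set L := W.subgroupH1 p (κ.layerSubgroup n) with hL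
  set h := W.layerToInfty κ n with hh
  let S : AddSubgroup L := W.selmerLayer κ n ⊓ (DistribSMul.toAddMonoidHom L p).ker
  have hS : ∀ y : L, y ∈ S ↔ y ∈ W.selmerLayer κ n ∧ p • y = 0 := fun y ↦ by
    simp only [S, AddSubgroup.mem_inf, AddMonoidHom.mem_ker, DistribSMul.toAddMonoidHom_apply]
  have hSel : Nat.card {z : W.selmerLayer κ n // p • z = 0} = Nat.card S := by
    let g : {z : W.selmerLayer κ n // p • z = 0} → S := fun z ↦ ⟨(z.1 : L), (hS _).mpr ⟨z.1.2, by
      rw [← AddSubgroup.coe_nsmul, z.2, AddSubgroup.coe_zero]⟩⟩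
    refine Nat.card_congr (Equiv.ofBijective g ⟨?_, ?_⟩)
    · intro z z' hzz'
      have := congrArg (fun w : S ↦ (w : L)) hzz'
      exact Subtype.ext (Subtype.ext this)
    · rintro ⟨y, hy⟩
      obtain ⟨hy1, hy2⟩ := (hS y).mp hy
      exact ⟨⟨⟨y, hy1⟩, Subtype.ext (by rw [AddSubgroup.coe_nsmul, AddSubgroup.coe_zero]; exact hy2)⟩, rfl⟩
  let ψ : S →+ W.subgroupH1 p κ.kerSubgroup := h.comp S.subtype
  -- kernel inside `(ker h)[p]`
  have hψker : Nat.card ψ.ker ≤ Nat.card {y : h.ker // p • y = 0} := by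
    haveI := hfin
    refine Nat.card_le_card_of_injective
      (fun y : ψ.ker ↦ (⟨⟨(y.1 : L), ?_⟩, ?_⟩ : {y : h.ker // p • y = 0})) ?_
    · have := (AddMonoidHom.mem_ker).mp y.2
      rw [AddMonoidHom.mem_ker]
      simpa [ψ] using this
    · apply Subtype.ext
      rw [AddSubgroup.coe_nsmul, AddSubgroup.coe_mk, AddSubgroup.coe_zero]
      exact ((hS _).mp y.1.2).2
    · intro y y' hyy'
      have := congrArg (fun w : {y : h.ker // p • y = 0} ↦ ((w.1 : h.ker) : L)) hyy'
      exact Subtype.ext (Subtype.ext this)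
  -- range inside `T_n`
  have hψrange : Nat.card ψ.range ≤ Nat.card {s : W.selmerInfty κ // p • s = 0 ∧
      W.conjH1 p κ.kerSubgroup (γ ^ p ^ n) (s : W.subgroupH1 p κ.kerSubgroup) = s} := by
    haveI := hT
    refine Nat.card_le_card_of_injective (fun x : ψ.range ↦ (⟨⟨x.1, ?_⟩, ?_, ?_⟩ : {s : W.selmerInfty κ //
      p • s = 0 ∧ W.conjH1 p κ.kerSubgroup (γ ^ p ^ n) (s : W.subgroupH1 p κ.kerSubgroup) = s})) ?_
    · obtain ⟨y, hy⟩ := x.2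
      rw [← hy]
      exact (mem_selmerInftyPreimage_iff W κ n _).mp
        (W.selmerLayer_le_selmerInftyPreimage κ n ((hS _).mp y.2).1)
    · obtain ⟨y, hy⟩ := x.2
      apply Subtype.ext
      rw [AddSubgroup.coe_nsmul, AddSubgroup.coe_mk, ← hy]
      change p • h (y : L) = 0
      rw [← map_nsmul, ((hS _).mp y.2).2, map_zero]
    · obtain ⟨y, hy⟩ := x.2
      rw [AddSubgroup.coe_mk, ← hy]
      exact conjH1_pow_layerToInfty W κ γ n (y : L)
    · intro x x' hxx'
      have := congrArg (fun s : {s : W.selmerInfty κ // p • s = 0 ∧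
        W.conjH1 p κ.kerSubgroup (γ ^ p ^ n) (s : W.subgroupH1 p κ.kerSubgroup) = s} ↦
          ((s.1 : W.selmerInfty κ) : W.subgroupH1 p κ.kerSubgroup)) hxx'
      exact Subtype.ext this
  rw [hSel, natCard_eq_natCard_ker_mul_natCard_range ψ]
  exact Nat.mul_le_mul hψker hψrange

/-- **`#A_n[p] ≤ #(ker h_n)[p] · #T_n`** (`A_n = h_n⁻¹(Sel_∞)`): the sharpening of KitE's
`natCard_layerClasses_le_mul` (same proof, the kernel lands in `(ker h_n)[p]`).
[cite: GreenbergLNM1716, §3 pp. 85–86 (Lemmas 3.1, 3.2)] -/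
theorem natCard_layerClasses_pTorsion_le_pTorsionKer_mul (γ : Field.absoluteGaloisGroup K) (n : ℕ)
    (hfin : Finite (W.layerToInfty κ n).ker)
    (hT : Finite {s : W.selmerInfty κ // p • s = 0 ∧
      W.conjH1 p κ.kerSubgroup (γ ^ p ^ n) (s : W.subgroupH1 p κ.kerSubgroup) = s}) :
    Nat.card {z : W.selmerInftyPreimage κ n // p • z = 0} ≤
      Nat.card {y : (W.layerToInfty κ n).ker // p • y = 0} * Nat.card {s : W.selmerInfty κ // p • s = 0 ∧
        W.conjH1 p κ.kerSubgroup (γ ^ p ^ n) (s : W.subgroupH1 p κ.kerSubgroup) = s} := by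
  set L := W.subgroupH1 p (κ.layerSubgroup n) with hL
  set h := W.layerToInfty κ n with hh
  let S : AddSubgroup L := W.selmerInftyPreimage κ n ⊓ (DistribSMul.toAddMonoidHom L p).ker
  have hS : ∀ y : L, y ∈ S ↔ y ∈ W.selmerInftyPreimage κ n ∧ p • y = 0 := fun y ↦ by
    simp only [S, AddSubgroup.mem_inf, AddMonoidHom.mem_ker, DistribSMul.toAddMonoidHom_apply]
  have hSel : Nat.card {z : W.selmerInftyPreimage κ n // p • z = 0} = Nat.card S := by
    let g : {z : W.selmerInftyPreimage κ n // p • z = 0} → S := fun z ↦ ⟨(z.1 : L), (hS _).mpr ⟨z.1.2, by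
      rw [← AddSubgroup.coe_nsmul, z.2, AddSubgroup.coe_zero]⟩⟩
    refine Nat.card_congr (Equiv.ofBijective g ⟨?_, ?_⟩)
    · intro z z' hzz'
      have := congrArg (fun w : S ↦ (w : L)) hzz'
      exact Subtype.ext (Subtype.ext this)
    · rintro ⟨y, hy⟩
      obtain ⟨hy1, hy2⟩ := (hS y).mp hy
      exact ⟨⟨⟨y, hy1⟩, Subtype.ext (by rw [AddSubgroup.coe_nsmul, AddSubgroup.coe_zero]; exact hy2)⟩, rfl⟩
  let ψ : S →+ W.subgroupH1 p κ.kerSubgroup := h.comp S.subtype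
  have hψker : Nat.card ψ.ker ≤ Nat.card {y : h.ker // p • y = 0} := by
    haveI := hfin
    refine Nat.card_le_card_of_injective
      (fun y : ψ.ker ↦ (⟨⟨(y.1 : L), ?_⟩, ?_⟩ : {y : h.ker // p • y = 0})) ?_
    · have := (AddMonoidHom.mem_ker).mp y.2
      rw [AddMonoidHom.mem_ker]
      simpa [ψ] using this
    · apply Subtype.ext
      rw [AddSubgroup.coe_nsmul, AddSubgroup.coe_mk, AddSubgroup.coe_zero]
      exact ((hS _).mp y.1.2).2
    · intro y y' hyy'
      have := congrArg (fun w : {y : h.ker // p • y = 0} ↦ ((w.1 : h.ker) : L)) hyy'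
      exact Subtype.ext (Subtype.ext this)
  have hψrange : Nat.card ψ.range ≤ Nat.card {s : W.selmerInfty κ // p • s = 0 ∧
      W.conjH1 p κ.kerSubgroup (γ ^ p ^ n) (s : W.subgroupH1 p κ.kerSubgroup) = s} := by
    haveI := hT
    refine Nat.card_le_card_of_injective (fun x : ψ.range ↦ (⟨⟨x.1, ?_⟩, ?_, ?_⟩ : {s : W.selmerInfty κ //
      p • s = 0 ∧ W.conjH1 p κ.kerSubgroup (γ ^ p ^ n) (s : W.subgroupH1 p κ.kerSubgroup) = s})) ?_
    · obtain ⟨y, hy⟩ := x.2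
      rw [← hy]
      exact (mem_selmerInftyPreimage_iff W κ n _).mp ((hS _).mp y.2).1
    · obtain ⟨y, hy⟩ := x.2
      apply Subtype.ext
      rw [AddSubgroup.coe_nsmul, AddSubgroup.coe_mk, ← hy]
      change p • h (y : L) = 0
      rw [← map_nsmul, ((hS _).mp y.2).2, map_zero]
    · obtain ⟨y, hy⟩ := x.2
      rw [AddSubgroup.coe_mk, ← hy]
      exact conjH1_pow_layerToInfty W κ γ n (y : L)
    · intro x x' hxx'
      have := congrArg (fun s : {s : W.selmerInfty κ // p • s = 0 ∧
        W.conjH1 p κ.kerSubgroup (γ ^ p ^ n) (s : W.subgroupH1 p κ.kerSubgroup) = s} ↦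
          ((s.1 : W.selmerInfty κ) : W.subgroupH1 p κ.kerSubgroup)) hxx'
      exact Subtype.ext this
  rw [hSel, natCard_eq_natCard_ker_mul_natCard_range ψ]
  exact Nat.mul_le_mul hψker hψrange

end Layer

end Summit.BirchSwinnertonDyer.BirchSwinnertonDyer.Theorems.TowerLayer

end
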